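import Mathlib
import HarnessLib
import Literature.Combinatorics.Additive.Pollard
import Literature.Combinatorics.Additive.Vosper
import Literature.Combinatorics.Additive.GrynkiewiczPollardRep
import Literature.Combinatorics.Additive.PollardEqualityModP
import Literature.Combinatorics.Additive.PollardEqualityModPProgression

/-!
# Equality in Pollard's theorem (Nazarewicz–O'Brien–O'Neill–Staples 2007), III: Theorem 3

Topic: `Literature/Combinatorics/Additive`.  E. Nazarewicz, M. O'Brien, M. O'Neill, C. Staples,
*Equality in Pollard's theorem on set addition of congruence classes*, Acta Arith. 127 (2007) 1–15
(held `paper:doi-10-4064-aa127-1-1`), **Theorem 3** (p. 2 and p. 7):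

«Let `p` be a prime number.  For `2 ≤ t ≤ min{|A|, |B|}`, the pair `(A, B)` of non-empty subsets of
`ℤ_p` is `t`-critical if and only if at least one of the following conditions holds:
(i) `min{|A|, |B|} = t`, (ii) `|A| + |B| ≥ p + t`, (iii) `|A| = |B| = t + 1` and `B = g − A` for some
`g ∈ ℤ_p`, (iv) `A` and `B` are arithmetic progressions with the same common difference.»

Here `(A,B)` is `t`-critical when equality holds in Pollard's theorem:
`N_1 + ⋯ + N_t = Σ_x min(t, r_{A,B}(x)) = t · min(p, |A| + |B| − t)` (tree: `pollard`).
Main statements: `PollardEquality.nazarewicz2007_thm3` (the printed iff) and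
`PollardEquality.nazarewicz2007_thm3_inverse` (the structural direction under `|A| + |B| < p + t`,
`min > t`).

## Proof organisation (and deviations from print)

The printed proof (§3, pp. 7–14) takes a minimal counterexample (minimal `t`, then `|A+B|` minimal,
`|A|+|B|` maximal, `|B|` minimal) and runs four steps on the sizes `|B(e)|` of the `e`-transforms
`B(e) = B ∩ (A − e)`.  We prove the same statement by strong induction on `|B|`, organised through the
complement duality and the level-`t` dual pair of `PollardEqualityModP.lean`:

* CASE A (an `e` with `t < |B(e)| < |B|`; printed Step 1): the transform `(A(e), B(e))` is `t`-critical
  (printed Lemma 7), so by induction it is a pair of progressions with a common difference `d`; then the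
  `t`-popular set `{r_{A,B} ≥ t} = {r_{A(e),B(e)} ≥ t}` is a progression of `|A|+|B|+1−2t` terms, its
  complement `D` is a progression, the dual pair `(D, −A)` is `t`-critical (`dual_pair_critical`), and
  printed LEMMA 1 (`isAP_of_critical_of_isAP`) applied twice gives that `A`, then `B`, are progressions
  with difference `d` (`isAP_of_etransform_isAP`).  DEVIATION: the printed Step 1 instead excludes such
  `e` by extremality.
* CASE B (an `e` with `0 < |B(e)| < t`; printed Step 2, pp. 8–10): for the `(|B|−t)`-critical complement
  pair `(Aᶜ, B)` (`critical_compl_left`) the same `e` has `|B| − t < |B ∩ (Aᶜ − e)| < |B|`, i.e. falls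
  under Case A.  DEVIATION: replaces the printed analysis of `(A'_e, B')` and of the progressions
  `X, Y` on pp. 9–10.
* CASE C (every `|B(e)| ∈ {0, t, |B|}`; printed Steps 3–4, pp. 10–12, followed as printed): with
  `E' = {e : B + e ⊆ A}` and `E(b) = {e ∈ A − b : B + e ⊄ A}`, Vosper gives `|E(b)| ≥ |B|` unless
  `|E'| = 1` and `|A| = |B|`; normalising `|A ∩ B| = t`, the criterion (5) and the `t`-critical transforms
  at `e ∈ E(b*)` give `A' + B' ⊆ ⋂_{b ∈ I} (b + A)`, and Lemma 8 makes `A` a progression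
  (`isAP_of_rigid`).  The SPECIAL CASE `|E'| = 1`, `|A| = |B|` (pp. 12–14), i.e. `A = e₀ + B`: for
  `2|B| < p` the printed argument ((7): `|B| > 2t`; `A', B'` are not progressions with a common
  difference; `|⋂_{e ∈ E(b*)} (B + e)| ≤ 1`; Lemma 8) is followed (`isAP_of_rigid_self_small`); for
  `2|B| > p` we DEVIATE: instead of the printed appeal to the Hamidoune–Rødseth theorem and the run
  analysis on pp. 13–14 we pass to the pair of complements `(Bᶜ, Bᶜ)`, which is
  `(p + t − 2|B|)`-critical (`critical_compl_compl`) and falls under the first sub-case.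
* The endpoint cases `min(|A|,|B|) = t + 1` (printed Lemmas 3–4, Corollary 1) and
  `|A| + |B| = p + t − 1` (printed Lemma 5) are `endpoint_card_succ` / `endpoint_card_add` of part I.

## References
* E. Nazarewicz, M. O'Brien, M. O'Neill, C. Staples, Acta Arith. 127 (2007) 1–15, Theorem 3 and its
  proof, §3 [cite: NazarewiczEtAl2007, Thm 3].
* J. M. Pollard, J. London Math. Soc. (2) 8 (1974) 460–462 [cite: Pollard1974, Thm 1].
* A. G. Vosper, J. London Math. Soc. 31 (1956) 200–205 [cite: Vosper1956, main theorem].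
-/

namespace Literature.Combinatorics.Additive

namespace PollardEquality

open Finset Pollard Grynkiewicz
open scoped Pointwise

section ZModP

variable {p : ℕ} [hp : Fact p.Prime]

/-! ### Case A: transfer from the `e`-transform -/

/-- Indices of a progression with nonzero difference are recovered below `p`. [folklore] -/
private theorem nat_eq_of_natCast_mul_eq {d : ZMod p} (hd : d ≠ 0) {i j : ℕ} (hi : i < p) (hj : j < p)
    (h : (i : ZMod p) * d = (j : ZMod p) * d) : i = j := by
  have h1 : (i : ZMod p) = (j : ZMod p) := mul_right_cancel₀ hd h
  have h2 := congrArg ZMod.val h1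
  rwa [ZMod.val_natCast, ZMod.val_natCast, Nat.mod_eq_of_lt hi, Nat.mod_eq_of_lt hj] at h2

/-- The middle of the sumset of two progressions is `t`-popular: for `A* = {a + i d : i < k}`,
`B* = {b + i d : i < ℓ}` with `t ≤ k`, `t ≤ ℓ ≤ p`, every `x = a + b + (t − 1 + j) d` with
`j ≤ k + ℓ − 2t` has `r_{A*,B*}(x) ≥ t`. [cite: NazarewiczEtAl2007, Thm 3 (proof, Step 1)] -/
theorem le_rep_apFinset_of_mem {d : ZMod p} (hd : d ≠ 0) (a b : ZMod p) {k l t : ℕ} (htk : t ≤ k)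
    (htl : t ≤ l) (hlp : l ≤ p) {x : ZMod p}
    (hx : x ∈ apFinset (a + b + (t - 1) • d) d (k + l + 1 - 2 * t)) :
    t ≤ rep (apFinset a d k) (apFinset b d l) x := by
  obtain ⟨j, hj, rfl⟩ := mem_apFinset.1 hx
  -- write the point as `a + b + n • d`, `n = t - 1 + j`
  set n := t - 1 + j with hn
  have hxn : a + b + (t - 1) • d + j • d = a + b + (n : ZMod p) * d := by
    rw [hn, nsmul_eq_mul, nsmul_eq_mul]; push_cast; ring
  rw [hxn, rep_eq_card_filter_right]
  set i₀ := t + j - k with hi₀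
  -- the `t` witnesses `b + (i₀ + s) d`, `s < t`
  have hwit : (range t).image (fun s : ℕ => b + ((i₀ + s : ℕ) : ZMod p) * d) ⊆
      (apFinset b d l).filter (fun b' => a + b + (n : ZMod p) * d - b' ∈ apFinset a d k) := by
    intro y hy
    obtain ⟨s, hs, rfl⟩ := mem_image.1 hy
    rw [mem_range] at hs
    rw [mem_filter, mem_apFinset, mem_apFinset]
    refine ⟨⟨i₀ + s, by omega, by rw [nsmul_eq_mul]⟩, ⟨n - (i₀ + s), by omega, ?_⟩⟩
    have hle : i₀ + s ≤ n := by omega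
    rw [nsmul_eq_mul, Nat.cast_sub hle]
    push_cast
    ring
  have hcard : #((range t).image (fun s : ℕ => b + ((i₀ + s : ℕ) : ZMod p) * d)) = t := by
    rw [card_image_of_injOn, card_range]
    intro s hs s' hs' h
    simp only [coe_range, Set.mem_Iio] at hs hs'
    have h1 : ((i₀ + s : ℕ) : ZMod p) * d = ((i₀ + s' : ℕ) : ZMod p) * d := add_left_cancel h
    have := nat_eq_of_natCast_mul_eq hd (by omega) (by omega) h1
    omega
  calc t = #((range t).image (fun s : ℕ => b + ((i₀ + s : ℕ) : ZMod p) * d)) := hcard.symm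
    _ ≤ _ := card_le_card hwit

/-- **Case A (transfer).**  Let `(A, B)` be `t`-critical with `2 ≤ t`, `t + 1 ≤ |A|`, `t + 1 ≤ |B|`,
`|A| + |B| ≤ p + t − 2`, and let `e` be such that `|B(e)| ≥ t` and the `e`-transform
`(A ∪ (B + e), B ∩ (A − e))` consists of two arithmetic progressions with a common difference `d ≠ 0`.
Then `A` and `B` are arithmetic progressions with difference `d`.  (Transform `t`-critical by Lemma 7;
the `t`-popular sums of `(A,B)` are those of the transform, a progression of `|A|+|B|+1−2t` terms; the
dual pair `(D, −A)` with `D = {r < t}` is `t`-critical; Lemma 1 twice.)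
[cite: NazarewiczEtAl2007, Thm 3 (proof, Step 1) and Lemma 1] -/
theorem isAP_of_etransform_isAP {A B : Finset (ZMod p)} {t : ℕ} {e d : ZMod p} (hd : d ≠ 0)
    (ht : 2 ≤ t) (htA : t + 1 ≤ #A) (htB : t + 1 ≤ #B) (hAB : #A + #B ≤ p + t - 2)
    (hcrit : ∑ x, min t (rep A B x) = t * (#A + #B - t)) (hte : t ≤ #(B ∩ (-e +ᵥ A)))
    (hA1 : IsAP (A ∪ (e +ᵥ B)) d) (hB1 : IsAP (B ∩ (-e +ᵥ A)) d) : IsAP A d ∧ IsAP B d := by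
  have hp2 := hp.out.two_le
  have hAp : #A ≤ p := (card_le_univ A).trans (ZMod.card p).le
  obtain ⟨hcrit1, hpt⟩ := etransform_critical e (by omega) (by omega) hte (by omega) hcrit
  obtain ⟨a₁, hA1eq⟩ := hA1
  obtain ⟨b₁, hB1eq⟩ := hB1
  set k₁ := #(A ∪ (e +ᵥ B)) with hk₁
  set l₁ := #(B ∩ (-e +ᵥ A)) with hl₁
  have hsum1 : k₁ + l₁ = #A + #B := card_etransform A B e
  have hk₁t : t ≤ k₁ := by have := card_le_card (subset_union_left (s₁ := A) (s₂ := e +ᵥ B)); omega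
  have hl₁p : l₁ ≤ p := (card_le_univ _).trans (ZMod.card p).le
  -- the popular set of `(A, B)` is the middle progression
  obtain ⟨C, hC⟩ : ∃ C : Finset (ZMod p), C = univ.filter fun x => t ≤ rep A B x := ⟨_, rfl⟩
  have hCsub : apFinset (a₁ + b₁ + (t - 1) • d) d (k₁ + l₁ + 1 - 2 * t) ⊆ C := by
    intro x hx
    rw [hC, mem_filter]
    refine ⟨mem_univ _, ?_⟩
    have h1 := le_rep_apFinset_of_mem hd a₁ b₁ hk₁t hte hl₁p hx
    rw [← hA1eq, ← hB1eq] at h1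
    have h2 := hpt x
    have h3 : min t (rep (A ∪ (e +ᵥ B)) (B ∩ (-e +ᵥ A)) x) = t := min_eq_left h1
    rw [h3] at h2
    exact (min_eq_left_iff.1 h2.symm)
  have hCle := card_popular_le (by omega) (by omega) (by omega) (by omega) hcrit
  rw [← hC] at hCle
  have hn : k₁ + l₁ + 1 - 2 * t ≤ p := by omega
  have hCeq : C = apFinset (a₁ + b₁ + (t - 1) • d) d (k₁ + l₁ + 1 - 2 * t) := by
    symm
    refine eq_of_subset_of_card_le hCsub ?_
    rw [card_apFinset hd hn]; omega
  have hCcard : #C = k₁ + l₁ + 1 - 2 * t := by rw [hCeq, card_apFinset hd hn]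
  have hCAP : IsAP C d := ⟨a₁ + b₁ + (t - 1) • d, by rw [hCcard]; exact hCeq⟩
  -- its complement `D = {r < t}` is a progression
  obtain ⟨D, hD⟩ : ∃ D : Finset (ZMod p), D = univ.filter fun x => rep A B x < t := ⟨_, rfl⟩
  have hDC : D = Cᶜ := by
    rw [hD, hC]; ext x; simp [not_le]
  have hDAP : IsAP D d := by rw [hDC]; exact hCAP.compl hd
  have hDcard : #D = p - #C := by rw [hDC, card_compl, ZMod.card]
  -- the dual pair `(D, -A)` is `t`-critical
  obtain ⟨hDt, hdual⟩ := dual_pair_critical (by omega) (by omega) (by omega) (by omega) hcrit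
  rw [← hD] at hDt hdual
  have hmin : min p (#D + #A - t) = #D + #A - t := min_eq_right (by omega)
  rw [hmin] at hdual
  have hnegA : #(-A) = #A := card_neg A
  have hdual' : ∑ x, min t (rep D (-A) x) = t * (#D + #(-A) - t) := by rw [hnegA]; exact hdual
  -- Lemma 1 for `(D, -A)`: `-A` is a progression with difference `d`
  have hnegAP : IsAP (-A) d :=
    isAP_of_critical_of_isAP hd hDAP ht (by omega) (by rw [hnegA]; omega) (by rw [hnegA]; omega) hdual'
  have hAAP : IsAP A d := by have := hnegAP.neg; rwa [neg_neg] at this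
  -- Lemma 1 for `(A, B)`
  exact ⟨hAAP, isAP_of_critical_of_isAP hd hAAP ht (by omega) (by omega) (by omega) hcrit⟩

/-- The complement of a translate: `B ∩ (Aᶜ − e) = B ∖ (A − e)`, so
`|B ∩ (Aᶜ − e)| + |B ∩ (A − e)| = |B|`. [cite: NazarewiczEtAl2007, Thm 3 (proof, Step 2)] -/
theorem card_inter_vadd_compl (A B : Finset (ZMod p)) (e : ZMod p) :
    #(B ∩ (-e +ᵥ Aᶜ)) + #(B ∩ (-e +ᵥ A)) = #B := by
  have hset : B ∩ (-e +ᵥ Aᶜ) = B.filter (fun b => ¬ b ∈ (-e +ᵥ A)) := by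
    ext b
    simp only [mem_inter, mem_filter, mem_neg_vadd_finset_iff, mem_compl]
  have hset' : B ∩ (-e +ᵥ A) = B.filter (fun b => b ∈ (-e +ᵥ A)) := by
    ext b; simp only [mem_inter, mem_filter]
  rw [hset, hset', add_comm]
  exact card_filter_add_card_filter_not _

/-! ### Translation and counting tools for the rigid case -/

/-- `S_t(c + A, B) = S_t(A, B)`. [cite: NazarewiczEtAl2007, §1 (translation invariance)] -/
theorem sum_min_rep_vadd_left (A B : Finset (ZMod p)) (c : ZMod p) (t : ℕ) :
    ∑ x, min t (rep (c +ᵥ A) B x) = ∑ x, min t (rep A B x) := by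
  have h := sum_min_rep_image_add A B c 0 t
  have hB : B.image (· + (0 : ZMod p)) = B := by
    conv_rhs => rw [← image_id (s := B)]
    exact image_congr fun x _ => by simp
  rw [hB, ← vadd_finset_eq_image] at h
  exact h

/-- `#{e : e + b ∈ A} = |A|`. [cite: NazarewiczEtAl2007, Thm 3 (proof, p. 10: "|E'| … is independent of b")] -/
theorem card_filter_add_mem_eq (A : Finset (ZMod p)) (b : ZMod p) :
    #(univ.filter fun e : ZMod p => e + b ∈ A) = #A := by
  refine card_nbij' (fun e => e + b) (fun a => a - b) ?_ ?_ ?_ ?_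
  · intro e he; simpa using he
  · intro a ha; simpa using ha
  · intro e _; simp
  · intro a _; simp

/-- `Σ_e |B ∩ (A − e)| = |A| |B|` (the computation (7): "write `|(A − e) ∩ B| = Σ_x χ_A(x + e) χ_B(x)`
… then change the order of summation"). [cite: NazarewiczEtAl2007, Thm 3 (proof, (7))] -/
theorem sum_card_inter_neg_vadd (A B : Finset (ZMod p)) :
    ∑ e : ZMod p, #(B ∩ (-e +ᵥ A)) = #A * #B := by
  have h1 : ∀ e : ZMod p, #(B ∩ (-e +ᵥ A)) = ∑ b ∈ B, if e + b ∈ A then 1 else 0 := by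
    intro e
    rw [sum_boole, Nat.cast_id]
    congr 1; ext b
    simp only [mem_inter, mem_filter, mem_neg_vadd_finset_iff, vadd_eq_add]
  rw [Fintype.sum_congr _ _ h1, sum_comm]
  have h2 : ∀ b ∈ B, (∑ e : ZMod p, if e + b ∈ A then 1 else 0) = #A := by
    intro b _
    rw [sum_boole, Nat.cast_id]
    exact card_filter_add_mem_eq A b
  rw [sum_congr rfl h2, sum_const, smul_eq_mul, mul_comm]

/-- `B ∩ (A − e) ≠ ∅` iff `e ∈ A − B` (written `A + (−B)`). [cite: NazarewiczEtAl2007, Thm 3 (proof, p. 10)] -/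
theorem inter_neg_vadd_nonempty_iff (A B : Finset (ZMod p)) (e : ZMod p) :
    (B ∩ (-e +ᵥ A)).Nonempty ↔ e ∈ A + (-B) := by
  constructor
  · rintro ⟨b, hb⟩
    rw [mem_inter, mem_neg_vadd_finset_iff, vadd_eq_add] at hb
    exact mem_add.2 ⟨e + b, hb.2, -b, neg_mem_neg hb.1, by abel⟩
  · intro h
    obtain ⟨a, ha, c, hc, rfl⟩ := mem_add.1 h
    have hc' : -c ∈ B := by simpa using neg_mem_neg hc
    refine ⟨-c, mem_inter.2 ⟨hc', ?_⟩⟩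
    rw [mem_neg_vadd_finset_iff, vadd_eq_add]
    simpa using ha

/-- `Aᶜ − e = (A − e)ᶜ` (plumbing). [folklore] -/
private theorem neg_vadd_compl (A : Finset (ZMod p)) (e : ZMod p) : -e +ᵥ Aᶜ = (-e +ᵥ A)ᶜ := by
  ext x
  simp only [mem_neg_vadd_finset_iff, mem_compl]

/-- A nonempty proper subset of `ℤ/pℤ` is not invariant under a nonzero translation:
`c + B ⊆ B` forces `c = 0` when `0 < |B| < p`. [cite: Nathanson1996, §2.3 (proof of Thm 2.1)] -/
theorem eq_zero_of_vadd_subset {B : Finset (ZMod p)} (hB : B.Nonempty) (hBp : #B < p) {c : ZMod p}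
    (h : c +ᵥ B ⊆ B) : c = 0 := by
  by_contra hc
  have hall : ∀ b ∈ B, b + c ∈ B := fun b hb => by
    rw [add_comm]; exact h (vadd_mem_vadd_finset hb)
  have := Pollard.eq_univ_of_add_mem hB hc hall
  rw [this, card_univ, ZMod.card] at hBp
  exact lt_irrefl _ hBp

/-! ### The core step of the rigid case -/

/-- **Core step** (p. 11): let `(A,B)` be `t`-critical with `|A ∩ B| = t`, and let `e` be such that
`B(e) = B ∩ (A − e)` has exactly `t` elements and contains `b* ∈ A ∩ B`.  Then for all `a' ∈ A ∖ B`,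
`b' ∈ B ∖ A` one has `a' + b' − b* ∈ A ∪ (B + e)` — from
`A' + B' ⊆ {r_{A,B} ≥ t} = {r_{A(e),B(e)} = t} = ⋂_{b ∈ B(e)} (b + A(e))`.
[cite: NazarewiczEtAl2007, Thm 3 (proof, p. 11)] -/
theorem sub_mem_union_vadd_of_critical {A B : Finset (ZMod p)} {t : ℕ} (ht : 1 ≤ t)
    (hI : #(A ∩ B) = t) (hAB : #A + #B ≤ p + t)
    (hcrit : ∑ x, min t (rep A B x) = t * (#A + #B - t))
    {e bs : ZMod p} (hbs : bs ∈ B ∩ (-e +ᵥ A)) (hIe : #(B ∩ (-e +ᵥ A)) = t)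
    {a' b' : ZMod p} (ha' : a' ∈ A \ B) (hb' : b' ∈ B \ A) :
    a' + b' - bs ∈ A ∪ (e +ᵥ B) := by
  have hU : #(A ∪ B) = #A + #B - t := by
    have := card_union_add_card_inter A B; omega
  have hcritU : ∑ x, min t (rep A B x) = t * #(A ∪ B) := by rw [hU]; exact hcrit
  have hpop : t ≤ rep A B (a' + b') :=
    (le_rep_iff_of_critical hI hcritU _).2 fun i hi =>
      (critical_iff_of_card_inter hI).1 hcritU a' ha' b' hb' i hi
  have htA : t ≤ #A := by rw [← hI]; exact card_le_card inter_subset_left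
  obtain ⟨-, hpt⟩ := etransform_critical e ht htA (by rw [hIe]) hAB hcrit
  have h1 : min t (rep (A ∪ (e +ᵥ B)) (B ∩ (-e +ᵥ A)) (a' + b')) = t := by
    rw [hpt]; exact min_eq_left hpop
  have h2 : rep (A ∪ (e +ᵥ B)) (B ∩ (-e +ᵥ A)) (a' + b') ≤ t := hIe ▸ rep_le_card_right _ _ _
  have h3 : rep (A ∪ (e +ᵥ B)) (B ∩ (-e +ᵥ A)) (a' + b') = #(B ∩ (-e +ᵥ A)) := by
    rw [hIe]; have := min_eq_right h2; omega
  exact (rep_eq_card_right_iff _ _ _).1 h3 bs hbs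

/-- **The rigid case, normalised** (`|A ∩ B| = t`; pp. 10–11): if `(A,B)` is `t`-critical with `2 ≤ t`,
`|A|, |B| ≥ t + 2`, `|A| + |B| ≤ p + t − 2`, every transform `B(e) ∋ b` with `B + e ⊄ A` has exactly
`t` elements, and for every `b* ∈ A ∩ B` the set `E(b*) = {e : e + b* ∈ A, B + e ⊄ A}` has at least
`|B|` elements, then `A' + B' ⊆ ⋂_{b ∈ A ∩ B} (b + A)` and, by Lemma 8, `A` is an arithmetic progression.
[cite: NazarewiczEtAl2007, Thm 3 (proof, pp. 10–11, display (6))] -/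
theorem isAP_of_rigid_normalized {A B : Finset (ZMod p)} {t : ℕ} (ht : 2 ≤ t) (hI : #(A ∩ B) = t)
    (htA : t + 2 ≤ #A) (htB : t + 2 ≤ #B) (hAB : #A + #B ≤ p + t - 2)
    (hcrit : ∑ x, min t (rep A B x) = t * (#A + #B - t))
    (hrig : ∀ e bs : ZMod p, bs ∈ B ∩ (-e +ᵥ A) → ¬ (e +ᵥ B ⊆ A) → #(B ∩ (-e +ᵥ A)) = t)
    (hE : ∀ bs ∈ A ∩ B, #B ≤ #(univ.filter fun e : ZMod p => e + bs ∈ A ∧ ¬ (e +ᵥ B ⊆ A))) :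
    ∃ d, d ≠ 0 ∧ IsAP A d := by
  have hp2 := hp.out.two_le
  -- `A' + B' ⊆ bs + A` for every `bs ∈ A ∩ B`
  have hkey : ∀ bs ∈ A ∩ B, ∀ a' ∈ A \ B, ∀ b' ∈ B \ A, a' + b' - bs ∈ A := by
    intro bs hbs a' ha' b' hb'
    by_contra hyA
    set y := a' + b' - bs with hy
    obtain ⟨X, hX⟩ : ∃ X : Finset (ZMod p),
        X = univ.filter fun e : ZMod p => e + bs ∈ A ∧ ¬ (e +ᵥ B ⊆ A) := ⟨_, rfl⟩
    have hyX : ∀ e ∈ X, y - e ∈ B := by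
      intro e he
      rw [hX, mem_filter] at he
      have hbs' : bs ∈ B ∩ (-e +ᵥ A) := by
        rw [mem_inter, mem_neg_vadd_finset_iff, vadd_eq_add]
        exact ⟨(mem_inter.1 hbs).2, he.2.1⟩
      have hmem := sub_mem_union_vadd_of_critical (by omega) hI (by omega) hcrit hbs'
        (hrig e bs hbs' he.2.2) ha' hb'
      rcases mem_union.1 hmem with h | h
      · exact absurd h hyA
      · obtain ⟨b, hb, hbe⟩ := mem_vadd_finset.1 h
        rw [vadd_eq_add] at hbe
        have : y - e = b := by rw [hy, ← hbe]; abel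
        rw [this]; exact hb
    have hyY : y ∈ univ.filter (fun z => ∀ e ∈ X, z - e ∈ B) := by
      rw [mem_filter]; exact ⟨mem_univ _, hyX⟩
    have hXcard : #B ≤ #X := by rw [hX]; exact hE bs hbs
    rcases hXcard.eq_or_lt with heq | hlt
    · -- `|X| = |B|`: `X = y - B`, so `y - bs ∈ X`, i.e. `y ∈ A`
      have hXeq := eq_image_sub_of_mem_filter heq.symm hyY
      have hmem : y - bs ∈ X := by
        rw [hXeq]; exact mem_image.2 ⟨bs, (mem_inter.1 hbs).2, rfl⟩
      rw [hX, mem_filter] at hmem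
      have : y - bs + bs = y := sub_add_cancel y bs
      rw [this] at hmem
      exact hyA hmem.2.1
    · rw [filter_forall_sub_mem_eq_empty hlt] at hyY
      simp at hyY
  -- so `A' + B'` lies in `⋂_{b ∈ I} (b + A)`
  obtain ⟨Z, hZ⟩ : ∃ Z : Finset (ZMod p), Z = univ.filter fun x => ∀ i ∈ A ∩ B, x - i ∈ A := ⟨_, rfl⟩
  have hsub : (A \ B) + (B \ A) ⊆ Z := by
    intro x hx
    obtain ⟨a', ha', b', hb', rfl⟩ := mem_add.1 hx
    rw [hZ, mem_filter]
    exact ⟨mem_univ _, fun i hi => hkey i hi a' ha' b' hb'⟩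
  have hA' : #(A \ B) = #A - t := by have := card_sdiff_add_card_inter A B; omega
  have hB' : #(B \ A) = #B - t := by
    have := card_sdiff_add_card_inter B A; rw [inter_comm] at this; omega
  have hA'ne : (A \ B).Nonempty := card_pos.1 (by rw [hA']; omega)
  have hB'ne : (B \ A).Nonempty := card_pos.1 (by rw [hB']; omega)
  have hcd := ZMod.cauchy_davenport hp.out hA'ne hB'ne
  rw [hA', hB', min_eq_right (by omega)] at hcd
  have hZcard : #A - t + (#B - t) - 1 ≤ #Z := hcd.trans (card_le_card hsub)
  have hAp : #A + 2 ≤ p := by omega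
  obtain ⟨-, h8⟩ := lemma8 (B := A) (X := A ∩ B) (s := t) ht (by omega) hAp hI
    (by rw [← hZ]; omega)
  exact h8 (by omega)

/-- **The special case `A = B`, small sets** (`|E'| = 1`, `|A| = |B|`, `|B| < (p+1)/2`; p. 12): if
`(B, B)` is `t`-critical with `2 ≤ t`, `|B| ≥ t + 2`, `2|B| < p`, and every
`B ∩ (B − e)` with `e ≠ 0` is empty or has exactly `t` elements, then `B` is an arithmetic progression.
(As printed: (7) and Vosper give `|B| > 2t`; with `A = B − e₁`, `|A ∩ B| = t`, the sets `A', B'` are not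
progressions with a common difference, `|⋂_{e ∈ E(b*)} (B + e)| ≤ 1` for each `b* ∈ I`, and Lemma 8.)
[cite: NazarewiczEtAl2007, Thm 3 (proof, p. 12)] -/
theorem isAP_of_rigid_self_small {B : Finset (ZMod p)} {t : ℕ} (ht : 2 ≤ t) (htB : t + 2 ≤ #B)
    (hBp : #B + #B + 1 ≤ p)
    (hcrit : ∑ x, min t (rep B B x) = t * (#B + #B - t))
    (hrig : ∀ e : ZMod p, e ≠ 0 → #(B ∩ (-e +ᵥ B)) = 0 ∨ #(B ∩ (-e +ᵥ B)) = t) :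
    ∃ d, d ≠ 0 ∧ IsAP B d := by
  have hp2 := hp.out.two_le
  by_contra hBAP
  push Not at hBAP
  set ℓ := #B with hℓ
  have hBne : B.Nonempty := card_pos.1 (by omega)
  have hnegB : #(-B) = ℓ := card_neg B
  -- (7), first half: `|B - B| ≥ 2|B|` by Vosper
  have hBB2 : ℓ + ℓ ≤ #(B + (-B)) := by
    have hcd := ZMod.cauchy_davenport hp.out hBne (card_pos.1 (by rw [hnegB]; omega) : (-B).Nonempty)
    rw [hnegB, min_eq_right (by omega)] at hcd
    by_contra hlt
    have heq : #(B + (-B)) = #B + #(-B) - 1 := by rw [hnegB]; omega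
    obtain ⟨d, hd, hBd, -⟩ := vosper_inverse (by omega) (by rw [hnegB]; omega) heq (by omega)
    exact hBAP d hd hBd
  -- the transforms: `|B ∩ (B - e)| = t` for `e ∈ (B - B) ∖ {0}`, `= 0` off `B - B`
  have ht_of_mem : ∀ e ∈ (B + (-B)).erase 0, #(B ∩ (-e +ᵥ B)) = t := by
    intro e he
    rw [mem_erase] at he
    have hne := (inter_neg_vadd_nonempty_iff B B e).2 he.2
    rcases hrig e he.1 with h | h
    · exact absurd (card_eq_zero.1 h) hne.ne_empty
    · exact h
  have h0_of_not_mem : ∀ e : ZMod p, e ∉ B + (-B) → #(B ∩ (-e +ᵥ B)) = 0 := by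
    intro e he
    rw [card_eq_zero, ← not_nonempty_iff_eq_empty, inter_neg_vadd_nonempty_iff]
    exact he
  -- (7): `ℓ² = ℓ + t (|B - B| - 1)`
  have h0mem : (0 : ZMod p) ∈ B + (-B) := by
    obtain ⟨b, hb⟩ := hBne
    exact mem_add.2 ⟨b, hb, -b, neg_mem_neg hb, add_neg_cancel b⟩
  have hcount : ℓ * ℓ = ℓ + t * (#(B + (-B)) - 1) := by
    have h := sum_card_inter_neg_vadd B B
    rw [← sum_filter_add_sum_filter_not univ (fun e => e ∈ B + (-B))] at h
    have hS : univ.filter (fun e : ZMod p => e ∈ B + (-B)) = B + (-B) := by ext e; simp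
    rw [hS] at h
    have hzero : ∑ e ∈ univ.filter (fun e : ZMod p => ¬ e ∈ B + (-B)), #(B ∩ (-e +ᵥ B)) = 0 :=
      sum_eq_zero fun e he => h0_of_not_mem e (mem_filter.1 he).2
    rw [hzero, add_zero, ← add_sum_erase _ _ h0mem] at h
    have hself : #(B ∩ (-(0 : ZMod p) +ᵥ B)) = ℓ := by rw [neg_zero, zero_vadd, inter_self]
    rw [hself, sum_const_nat (m := t) ht_of_mem, card_erase_of_mem h0mem] at h
    rw [← h]; ring
  have hl2t : 2 * t + 1 ≤ ℓ := by
    by_contra hlt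
    push Not at hlt
    have h1 : ℓ + t * (ℓ + ℓ - 1) ≤ ℓ + t * (#(B + (-B)) - 1) :=
      Nat.add_le_add_left (Nat.mul_le_mul_left _ (by omega)) _
    rw [← hcount] at h1
    have h2 : ℓ * ℓ ≤ 2 * t * ℓ := Nat.mul_le_mul_right ℓ (by omega)
    have h3 : t * (ℓ + ℓ - 1) + t = 2 * t * ℓ := by
      have : ℓ + ℓ - 1 + 1 = 2 * ℓ := by omega
      rw [← mul_add_one, this]; ring
    omega
  -- choose `e₁ ∈ (B - B) ∖ {0}` and set `A = B - e₁`
  have hSne : ((B + (-B)).erase 0).Nonempty := card_pos.1 (by rw [card_erase_of_mem h0mem]; omega)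
  obtain ⟨e₁, he₁⟩ := hSne
  have he₁0 : e₁ ≠ 0 := (mem_erase.1 he₁).1
  set A := -e₁ +ᵥ B with hA
  have hAcard : #A = ℓ := card_vadd_finset _ B
  have hI : #(A ∩ B) = t := by rw [inter_comm]; exact ht_of_mem e₁ he₁
  have hcritA : ∑ x, min t (rep A B x) = t * (#A + #B - t) := by
    rw [hAcard, hA, sum_min_rep_vadd_left]; exact hcrit
  have hAp : ℓ + 2 ≤ p := by omega
  -- `B + e ⊆ A` only for `e = -e₁`
  have hE' : ∀ e : ZMod p, e +ᵥ B ⊆ A ↔ e = -e₁ := by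
    intro e
    rw [hA, subset_vadd_finset_iff, neg_neg, vadd_vadd]
    constructor
    · intro h
      have := eq_zero_of_vadd_subset hBne (by omega) h
      exact eq_neg_of_add_eq_zero_right this
    · rintro rfl; rw [add_neg_cancel, zero_vadd]
  -- the transforms at the relevant `e` have `t` elements
  have hrigA : ∀ e bs : ZMod p, bs ∈ B ∩ (-e +ᵥ A) → ¬ (e +ᵥ B ⊆ A) → #(B ∩ (-e +ᵥ A)) = t := by
    intro e bs hbs hne
    have he : e + e₁ ≠ 0 := by
      intro h; rw [hE'] at hne; exact hne (eq_neg_of_add_eq_zero_left h)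
    have hset : B ∩ (-e +ᵥ A) = B ∩ (-(e + e₁) +ᵥ B) := by rw [hA, vadd_vadd, neg_add]
    rw [hset] at hbs ⊢
    rcases hrig (e + e₁) he with h | h
    · exact ((Finset.nonempty_iff_ne_empty.1 ⟨bs, hbs⟩) (card_eq_zero.1 h)).elim
    · exact h
  -- `|E(bs)| = ℓ - 1`
  have hEcard : ∀ bs ∈ A ∩ B,
      #(univ.filter fun e : ZMod p => e + bs ∈ A ∧ ¬ (e +ᵥ B ⊆ A)) = ℓ - 1 := by
    intro bs hbs
    have hset : (univ.filter fun e : ZMod p => e + bs ∈ A ∧ ¬ (e +ᵥ B ⊆ A)) =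
        (univ.filter fun e : ZMod p => e + bs ∈ A).erase (-e₁) := by
      ext e
      simp only [mem_filter, mem_erase, mem_univ, true_and, hE' e]
      tauto
    have hmem : -e₁ ∈ univ.filter (fun e : ZMod p => e + bs ∈ A) := by
      rw [mem_filter, hA, mem_neg_vadd_finset_iff, vadd_eq_add]
      refine ⟨mem_univ _, ?_⟩
      rw [add_neg_cancel_left]; exact (mem_inter.1 hbs).2
    rw [hset, card_erase_of_mem hmem, card_filter_add_mem_eq, hAcard]
  -- for `bs ∈ I`, `a' ∈ A'`, `b' ∈ B'`: `a' + b' - bs ∈ A` or it lies in the small set `Y(bs)`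
  have hY : ∀ bs ∈ A ∩ B, #(univ.filter fun z : ZMod p =>
      ∀ e ∈ (univ.filter fun e : ZMod p => e + bs ∈ A ∧ ¬ (e +ᵥ B ⊆ A)), z - e ∈ B) ≤ 1 := by
    intro bs hbs
    have h := card_iInter_vadd_le (B := B)
      (X := univ.filter fun e : ZMod p => e + bs ∈ A ∧ ¬ (e +ᵥ B ⊆ A))
      (by rw [hEcard bs hbs]; omega) (by rw [hEcard bs hbs]; omega) hAp hBAP
    rw [hEcard bs hbs] at h
    omega
  have hkey : ∀ bs ∈ A ∩ B, ∀ a' ∈ A \ B, ∀ b' ∈ B \ A, a' + b' - bs ∈ A ∨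
      a' + b' - bs ∈ univ.filter fun z : ZMod p =>
        ∀ e ∈ (univ.filter fun e : ZMod p => e + bs ∈ A ∧ ¬ (e +ᵥ B ⊆ A)), z - e ∈ B := by
    intro bs hbs a' ha' b' hb'
    by_cases hyA : a' + b' - bs ∈ A
    · exact Or.inl hyA
    · right
      rw [mem_filter]
      refine ⟨mem_univ _, fun e he => ?_⟩
      rw [mem_filter] at he
      have hbs' : bs ∈ B ∩ (-e +ᵥ A) := by
        rw [mem_inter, mem_neg_vadd_finset_iff, vadd_eq_add]
        exact ⟨(mem_inter.1 hbs).2, he.2.1⟩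
      have hmem := sub_mem_union_vadd_of_critical (by omega) hI (by omega) hcritA hbs'
        (hrigA e bs hbs' he.2.2) ha' hb'
      rcases mem_union.1 hmem with h | h
      · exact absurd h hyA
      · obtain ⟨b, hb, hbe⟩ := mem_vadd_finset.1 h
        rw [vadd_eq_add] at hbe
        have : a' + b' - bs - e = b := by rw [← hbe]; abel
        rw [this]; exact hb
  -- `A' + B' ⊆ Z ∪ F`, `|F| ≤ t`
  obtain ⟨Z, hZ⟩ : ∃ Z : Finset (ZMod p), Z = univ.filter fun x => ∀ i ∈ A ∩ B, x - i ∈ A := ⟨_, rfl⟩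
  obtain ⟨F, hF⟩ : ∃ F : Finset (ZMod p), F = (A ∩ B).biUnion fun bs => bs +ᵥ
      (univ.filter fun z : ZMod p =>
        ∀ e ∈ (univ.filter fun e : ZMod p => e + bs ∈ A ∧ ¬ (e +ᵥ B ⊆ A)), z - e ∈ B) := ⟨_, rfl⟩
  have hFcard : #F ≤ t := by
    rw [hF]
    refine card_biUnion_le.trans ?_
    calc ∑ bs ∈ A ∩ B, #(bs +ᵥ (univ.filter fun z : ZMod p =>
            ∀ e ∈ (univ.filter fun e : ZMod p => e + bs ∈ A ∧ ¬ (e +ᵥ B ⊆ A)), z - e ∈ B))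
        ≤ ∑ _bs ∈ A ∩ B, 1 := sum_le_sum fun bs hbs => by rw [card_vadd_finset]; exact hY bs hbs
      _ = t := by rw [sum_const, smul_eq_mul, mul_one, hI]
  have hsub : (A \ B) + (B \ A) ⊆ Z ∪ F := by
    intro x hx
    obtain ⟨a', ha', b', hb', rfl⟩ := mem_add.1 hx
    rw [mem_union]
    by_cases hall : ∀ i ∈ A ∩ B, a' + b' - i ∈ A
    · left; rw [hZ, mem_filter]; exact ⟨mem_univ _, hall⟩
    · right
      push Not at hall
      obtain ⟨bs, hbs, hnot⟩ := hall
      rcases hkey bs hbs a' ha' b' hb' with h | h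
      · exact absurd h hnot
      · rw [hF, mem_biUnion]
        refine ⟨bs, hbs, mem_vadd_finset.2 ⟨a' + b' - bs, h, ?_⟩⟩
        rw [vadd_eq_add]; abel
  -- `A', B'` are not progressions with a common difference, so `|A' + B'| ≥ |A'| + |B'|`
  have hA' : #(A \ B) = ℓ - t := by have := card_sdiff_add_card_inter A B; omega
  have hB' : #(B \ A) = ℓ - t := by
    have := card_sdiff_add_card_inter B A; rw [inter_comm] at this; omega
  have hA'ne : (A \ B).Nonempty := card_pos.1 (by rw [hA']; omega)
  have hB'ne : (B \ A).Nonempty := card_pos.1 (by rw [hB']; omega)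
  have hnotAP : ∀ d', d' ≠ 0 → IsAP (A \ B) d' → IsAP (B \ A) d' → False := by
    intro d' hd' hA'd hB'd
    obtain ⟨a₀, hA'eq⟩ := hA'd
    obtain ⟨b₀, hB'eq⟩ := hB'd
    rw [hA'] at hA'eq
    rw [hB'] at hB'eq
    set g := b₀ - a₀ with hg
    have hBg : B \ A = g +ᵥ (A \ B) := by
      rw [hA'eq, hB'eq, vadd_apFinset, hg, sub_add_cancel]
    -- `B ∩ (g + A) ⊇ B \ A` has more than `t` elements
    have hbig : ℓ - t ≤ #(B ∩ (-(-g) +ᵥ A)) := by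
      rw [neg_neg, ← hB']
      refine card_le_card fun x hx => mem_inter.2 ⟨(mem_sdiff.1 hx).1, ?_⟩
      rw [hBg] at hx
      obtain ⟨y, hy, rfl⟩ := mem_vadd_finset.1 hx
      exact vadd_mem_vadd_finset (mem_sdiff.1 hy).1
    have hset : B ∩ (-(-g) +ᵥ A) = B ∩ (-(e₁ - g) +ᵥ B) := by rw [hA, vadd_vadd]; congr 2; abel
    by_cases hge : e₁ - g = 0
    · -- `g = e₁`: then `I = A ∩ B` is invariant under `+ e₁`
      have hg1 : g = e₁ := (sub_eq_zero.1 hge).symm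
      have hBA : B = g +ᵥ A := by rw [hg1, hA, vadd_vadd, add_neg_cancel, zero_vadd]
      have hIinv : e₁ +ᵥ (A ∩ B) ⊆ A ∩ B := by
        intro x hx
        obtain ⟨i, hi, rfl⟩ := mem_vadd_finset.1 hx
        rw [vadd_eq_add]
        have hiA : i ∈ A := (mem_inter.1 hi).1
        have h1 : e₁ + i ∈ B := by
          rw [hBA, hg1]; exact vadd_mem_vadd_finset hiA
        refine mem_inter.2 ⟨?_, h1⟩
        -- if `e₁ + i ∉ A` then `e₁ + i ∈ B \ A = g + (A \ B)`, so `i ∈ A \ B`, contradiction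
        by_contra hniA
        have h2 : e₁ + i ∈ B \ A := mem_sdiff.2 ⟨h1, hniA⟩
        rw [hBg, hg1] at h2
        obtain ⟨y, hy, hye⟩ := mem_vadd_finset.1 h2
        rw [vadd_eq_add] at hye
        have : y = i := add_left_cancel hye
        rw [this] at hy
        exact (mem_sdiff.1 hy).2 (mem_inter.1 hi).2
      have hIne : (A ∩ B).Nonempty := card_pos.1 (by rw [hI]; omega)
      have := eq_zero_of_vadd_subset hIne (by rw [hI]; omega) hIinv
      exact he₁0 this
    · rcases hrig (e₁ - g) hge with h | h
      · rw [← hset] at h; omega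
      · rw [← hset] at h; omega
  have hsum : ℓ - t + (ℓ - t) ≤ #((A \ B) + (B \ A)) := by
    have hcd := ZMod.cauchy_davenport hp.out hA'ne hB'ne
    rw [hA', hB', min_eq_right (by omega)] at hcd
    by_contra hlt
    have heq : #((A \ B) + (B \ A)) = #(A \ B) + #(B \ A) - 1 := by rw [hA', hB']; omega
    obtain ⟨d', hd', h1, h2⟩ := vosper_inverse (by rw [hA']; omega) (by rw [hB']; omega) heq
      (by rw [heq, hA', hB']; omega)
    exact hnotAP d' hd' h1 h2
  -- count: `|Z| ≥ 2(ℓ - t) - t ≥ ℓ - t + 1`, then Lemma 8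
  have hZF := (card_le_card hsub).trans (card_union_le Z F)
  have hZcard : ℓ - t + (ℓ - t) ≤ #Z + t := by omega
  obtain ⟨-, h8⟩ := lemma8 (B := A) (X := A ∩ B) (s := t) ht (by omega) (by omega) hI
    (by rw [← hZ, hAcard]; omega)
  obtain ⟨d, hd, hAd⟩ := h8 (by omega)
  rw [hA, isAP_vadd_iff] at hAd
  exact hBAP d hd hAd

/-- **The special case `A = B`** (pp. 12–14): if `(B, B)` is `t`-critical with `2 ≤ t`, `|B| ≥ t + 2`,
`2|B| ≤ p + t − 2`, and every `B ∩ (B − e)` with `e ≠ 0` is empty or has `t` elements, then `B` is an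
arithmetic progression.  For `2|B| < p` this is `isAP_of_rigid_self_small`; for `2|B| > p` we pass to the
`(p + t − 2|B|)`-critical pair `(Bᶜ, Bᶜ)` (DEVIATION from the printed Hamidoune–Rødseth argument).
[cite: NazarewiczEtAl2007, Thm 3 (proof, pp. 12–14)] -/
theorem isAP_of_rigid_self {B : Finset (ZMod p)} {t : ℕ} (ht : 2 ≤ t) (htB : t + 2 ≤ #B)
    (hBB : #B + #B ≤ p + t - 2)
    (hcrit : ∑ x, min t (rep B B x) = t * (#B + #B - t))
    (hrig : ∀ e : ZMod p, e ≠ 0 → #(B ∩ (-e +ᵥ B)) = 0 ∨ #(B ∩ (-e +ᵥ B)) = t) :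
    ∃ d, d ≠ 0 ∧ IsAP B d := by
  have hprime := hp.out
  have hp2 := hprime.two_le
  by_cases hsmall : #B + #B + 1 ≤ p
  · exact isAP_of_rigid_self_small ht htB hsmall hcrit hrig
  · -- `2|B| ≥ p + 1` (`2|B| = p` is impossible for the odd prime `p`)
    have hodd : #B + #B ≠ p := by
      intro h
      have h2 : 2 ∣ p := ⟨#B, by omega⟩
      have := (Nat.dvd_prime hprime).1 h2
      omega
    have hbig : p + 1 ≤ #B + #B := by omega
    set ℓ := #B with hℓ
    have hc := critical_compl_compl (A := B) (B := B) (by omega) (by omega) (by omega) hcrit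
    have hcB : #Bᶜ = p - ℓ := by rw [card_compl, ZMod.card]
    set lam := p + t - ℓ - ℓ with hlam
    have hcrit' : ∑ x, min lam (rep Bᶜ Bᶜ x) = lam * (#Bᶜ + #Bᶜ - lam) := by
      rw [hc, hcB]; congr 1; omega
    have hrig' : ∀ e : ZMod p, e ≠ 0 → #(Bᶜ ∩ (-e +ᵥ Bᶜ)) = 0 ∨ #(Bᶜ ∩ (-e +ᵥ Bᶜ)) = lam := by
      intro e he
      right
      rw [neg_vadd_compl, ← compl_union, card_compl, ZMod.card]
      have hu := card_union_add_card_inter B (-e +ᵥ B)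
      rw [card_vadd_finset] at hu
      have hle : #(B ∪ (-e +ᵥ B)) ≤ p := (card_le_univ _).trans (ZMod.card p).le
      rcases hrig e he with h | h
      · omega
      · omega
    obtain ⟨d, hd, hAP⟩ := isAP_of_rigid_self_small (B := Bᶜ) (t := lam) (by omega)
      (by rw [hcB]; omega) (by rw [hcB]; omega) hcrit' hrig'
    refine ⟨d, hd, ?_⟩
    have := hAP.compl hd
    rwa [compl_compl] at this

/-- **The rigid case** (printed Steps 3–4, pp. 10–14): if `(A, B)` is `t`-critical with `2 ≤ t`,
`t + 2 ≤ |B| ≤ |A|`, `|A| + |B| ≤ p + t − 2`, and every `|B ∩ (A − e)|` lies in `{0, t, |B|}`, then `A`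
or `B` is an arithmetic progression. [cite: NazarewiczEtAl2007, Thm 3 (proof, Steps 3–4)] -/
theorem isAP_of_rigid {A B : Finset (ZMod p)} {t : ℕ} (ht : 2 ≤ t) (htB : t + 2 ≤ #B) (hBA : #B ≤ #A)
    (hAB : #A + #B ≤ p + t - 2)
    (hcrit : ∑ x, min t (rep A B x) = t * (#A + #B - t))
    (hrig : ∀ e : ZMod p, #(B ∩ (-e +ᵥ A)) = 0 ∨ #(B ∩ (-e +ᵥ A)) = t ∨ #(B ∩ (-e +ᵥ A)) = #B) :
    (∃ d, d ≠ 0 ∧ IsAP A d) ∨ (∃ d, d ≠ 0 ∧ IsAP B d) := by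
  have hp2 := hp.out.two_le
  by_cases hBAP : ∃ d, d ≠ 0 ∧ IsAP B d
  · exact Or.inr hBAP
  push Not at hBAP
  left
  set ℓ := #B with hℓ
  set k := #A with hk
  have hBne : B.Nonempty := card_pos.1 (by omega)
  have hAp : k + 2 ≤ p := by omega
  -- transforms at `e` with `b ∈ B(e)`, `B + e ⊄ A` have `t` elements
  have hrig' : ∀ e bs : ZMod p, bs ∈ B ∩ (-e +ᵥ A) → ¬ (e +ᵥ B ⊆ A) → #(B ∩ (-e +ᵥ A)) = t := by
    intro e bs hbs hne
    rcases hrig e with h | h | h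
    · exact ((Finset.nonempty_iff_ne_empty.1 ⟨bs, hbs⟩) (card_eq_zero.1 h)).elim
    · exact h
    · exfalso; apply hne
      have heq : B ∩ (-e +ᵥ A) = B := eq_of_subset_of_card_le inter_subset_left h.ge
      intro x hx
      obtain ⟨b, hb, rfl⟩ := mem_vadd_finset.1 hx
      have : b ∈ -e +ᵥ A := (mem_inter.1 (heq.symm ▸ hb)).2
      rwa [mem_neg_vadd_finset_iff] at this
  -- `E' = {e : B + e ⊆ A}` and `E(b)`
  obtain ⟨E', hE'⟩ : ∃ E' : Finset (ZMod p), E' = univ.filter fun e : ZMod p => e +ᵥ B ⊆ A := ⟨_, rfl⟩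
  have hEcard : ∀ b ∈ B,
      #(univ.filter fun e : ZMod p => e + b ∈ A ∧ ¬ (e +ᵥ B ⊆ A)) + #E' = k := by
    intro b hb
    have h1 := card_filter_add_card_filter_not (s := univ.filter fun e : ZMod p => e + b ∈ A)
      (fun e => ¬ (e +ᵥ B ⊆ A))
    rw [filter_filter, filter_filter, card_filter_add_mem_eq] at h1
    rw [hk, ← h1]
    congr 2
    rw [hE']
    refine filter_congr fun e _ => ?_
    simp only [not_not]
    constructor
    · intro h; exact ⟨h (vadd_mem_vadd_finset hb), h⟩
    · intro h; exact h.2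
  -- Vosper: `|E'| ≥ 2 ⇒ k ≥ ℓ + |E'|`
  have hV : 2 ≤ #E' → ℓ + #E' ≤ k := by
    intro h2
    have hsubA : B + E' ⊆ A := by
      intro x hx
      obtain ⟨b, hb, e, he, rfl⟩ := mem_add.1 hx
      rw [hE', mem_filter] at he
      rw [add_comm]; exact he.2 (vadd_mem_vadd_finset hb)
    have hE'ne : E'.Nonempty := card_pos.1 (by omega)
    have hne : B + E' ≠ univ := by
      intro h
      have := card_le_card hsubA
      rw [h, card_univ, ZMod.card] at this
      omega
    have hcd := Vosper.cauchy_davenport_of_ne_univ hBne hE'ne hne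
    by_contra hlt
    have heq : #(B + E') = #B + #E' - 1 := by
      have := card_le_card hsubA; omega
    obtain ⟨d, hd, hBd, -⟩ := vosper_inverse (by omega) h2 heq
      (by have := card_le_card hsubA; omega)
    exact hBAP d hd hBd
  by_cases hsp : #E' = 1 ∧ k = ℓ
  · -- the special case `A = e₀ + B`
    obtain ⟨e₀, hE'eq⟩ := card_eq_one.1 hsp.1
    have he₀ : e₀ +ᵥ B ⊆ A := by
      have : e₀ ∈ E' := by rw [hE'eq]; exact mem_singleton_self _
      rw [hE', mem_filter] at this
      exact this.2
    have hAeq : A = e₀ +ᵥ B := by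
      symm; refine eq_of_subset_of_card_le he₀ ?_
      rw [card_vadd_finset]; omega
    have hcritB : ∑ x, min t (rep B B x) = t * (#B + #B - t) := by
      have h := hcrit
      rw [hAeq, sum_min_rep_vadd_left] at h
      rw [h]; congr 1; omega
    have hrigB : ∀ e : ZMod p, e ≠ 0 → #(B ∩ (-e +ᵥ B)) = 0 ∨ #(B ∩ (-e +ᵥ B)) = t := by
      intro e he
      have h := hrig (e + e₀)
      rw [hAeq, vadd_vadd, neg_add, neg_add_cancel_right] at h
      rcases h with h | h | h
      · exact Or.inl h
      · exact Or.inr h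
      · exfalso
        have heq : B ∩ (-e +ᵥ B) = B := eq_of_subset_of_card_le inter_subset_left h.ge
        have hall : ∀ b ∈ B, b + e ∈ B := by
          intro b hb
          have : b ∈ -e +ᵥ B := (mem_inter.1 (heq.symm ▸ hb)).2
          rw [mem_neg_vadd_finset_iff, vadd_eq_add] at this
          rwa [add_comm]
        have := Pollard.eq_univ_of_add_mem hBne he hall
        rw [this, card_univ, ZMod.card] at hℓ
        omega
    obtain ⟨d, hd, hBd⟩ := isAP_of_rigid_self ht htB (by omega) hcritB hrigB
    exact absurd hBd (hBAP d hd)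
  · -- the main case: `|E(b)| ≥ ℓ`
    have hE : ∀ b ∈ B, ℓ ≤ #(univ.filter fun e : ZMod p => e + b ∈ A ∧ ¬ (e +ᵥ B ⊆ A)) := by
      intro b hb
      have h := hEcard b hb
      rcases Nat.lt_or_ge #E' 2 with hlt | hge
      · have h0 : #E' = 0 ∨ #E' = 1 := by omega
        rcases h0 with h0 | h0
        · omega
        · have hkl : k ≠ ℓ := fun hkl => hsp ⟨h0, hkl⟩
          omega
      · have := hV hge; omega
    -- pick `b₀ ∈ B`, `e₀ ∈ E(b₀)` and translate `A`
    obtain ⟨b₀, hb₀⟩ := hBne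
    have hEne : (univ.filter fun e : ZMod p => e + b₀ ∈ A ∧ ¬ (e +ᵥ B ⊆ A)).Nonempty :=
      card_pos.1 (by have := hE b₀ hb₀; omega)
    obtain ⟨e₀, he₀⟩ := hEne
    rw [mem_filter] at he₀
    set A₀ := -e₀ +ᵥ A with hA₀
    have hA₀card : #A₀ = k := card_vadd_finset _ A
    have hb₀I : b₀ ∈ B ∩ (-e₀ +ᵥ A) := by
      rw [mem_inter, mem_neg_vadd_finset_iff, vadd_eq_add]; exact ⟨hb₀, he₀.2.1⟩
    have hI : #(A₀ ∩ B) = t := by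
      rw [hA₀, inter_comm]; exact hrig' e₀ b₀ hb₀I he₀.2.2
    have hcritA₀ : ∑ x, min t (rep A₀ B x) = t * (#A₀ + #B - t) := by
      rw [hA₀card, hA₀, sum_min_rep_vadd_left]; exact hcrit
    -- translating the bookkeeping
    have hshift_inter : ∀ e : ZMod p, B ∩ (-e +ᵥ A₀) = B ∩ (-(e + e₀) +ᵥ A) := by
      intro e; rw [hA₀, vadd_vadd, neg_add]
    have hshift_sub : ∀ e : ZMod p, (e +ᵥ B ⊆ A₀) ↔ ((e + e₀) +ᵥ B ⊆ A) := by
      intro e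
      rw [hA₀, subset_vadd_finset_iff, neg_neg, vadd_vadd, add_comm e₀ e]
    have hrig₀ : ∀ e bs : ZMod p, bs ∈ B ∩ (-e +ᵥ A₀) → ¬ (e +ᵥ B ⊆ A₀) → #(B ∩ (-e +ᵥ A₀)) = t := by
      intro e bs hbs hne
      rw [hshift_inter] at hbs ⊢
      rw [hshift_sub] at hne
      exact hrig' (e + e₀) bs hbs hne
    have hE₀ : ∀ bs ∈ A₀ ∩ B,
        ℓ ≤ #(univ.filter fun e : ZMod p => e + bs ∈ A₀ ∧ ¬ (e +ᵥ B ⊆ A₀)) := by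
      intro bs hbs
      have hbsB : bs ∈ B := (mem_inter.1 hbs).2
      refine (hE bs hbsB).trans (le_of_eq ?_)
      refine card_nbij' (fun e => e - e₀) (fun e => e + e₀) ?_ ?_ ?_ ?_
      · intro e he
        simp only [mem_coe, mem_filter, mem_univ, true_and] at he ⊢
        rw [hshift_sub, sub_add_cancel, hA₀, mem_neg_vadd_finset_iff, vadd_eq_add]
        refine ⟨?_, he.2⟩
        have : e₀ + (e - e₀ + bs) = e + bs := by abel
        rw [this]; exact he.1
      · intro e he
        simp only [mem_coe, mem_filter, mem_univ, true_and] at he ⊢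
        rw [hshift_sub, hA₀, mem_neg_vadd_finset_iff, vadd_eq_add] at he
        have : e₀ + (e + bs) = e + e₀ + bs := by abel
        rw [this] at he
        exact he
      · intro e _; simp
      · intro e _; simp
    obtain ⟨d, hd, hA₀d⟩ := isAP_of_rigid_normalized ht hI (by rw [hA₀card]; omega) htB
      (by rw [hA₀card]; omega) hcritA₀ hrig₀ hE₀
    rw [hA₀, isAP_vadd_iff] at hA₀d
    exact ⟨d, hd, hA₀d⟩

/-! ### Theorem 3 -/

/-- **Case A step with the induction hypothesis**: if every `t'`-critical pair with a smaller second
set is structured, and `(A, B)` is `t`-critical with `t + 2 ≤ |A|, |B|`, `|A| + |B| ≤ p + t − 2` and has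
an `e` with `t < |B(e)| < |B|`, then `A` and `B` are progressions with a common difference.
[cite: NazarewiczEtAl2007, Thm 3 (proof, Step 1)] -/
theorem isAP_of_good_etransform {A B : Finset (ZMod p)} {t : ℕ}
    (ih : ∀ (A' B' : Finset (ZMod p)) (t' : ℕ), #B' < #B → 2 ≤ t' → t' + 1 ≤ #A' → t' + 1 ≤ #B' →
      #A' + #B' ≤ p + t' - 1 → ∑ x, min t' (rep A' B' x) = t' * (#A' + #B' - t') →
      (#A' = t' + 1 ∧ #B' = t' + 1 ∧ ∃ g, B' = A'.image (g - ·)) ∨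
        ∃ d, d ≠ 0 ∧ IsAP A' d ∧ IsAP B' d)
    (ht : 2 ≤ t) (htA : t + 2 ≤ #A) (htB : t + 2 ≤ #B) (hAB : #A + #B ≤ p + t - 2)
    (hcrit : ∑ x, min t (rep A B x) = t * (#A + #B - t)) {e : ZMod p}
    (he1 : t + 1 ≤ #(B ∩ (-e +ᵥ A))) (he2 : #(B ∩ (-e +ᵥ A)) + 1 ≤ #B) :
    ∃ d, d ≠ 0 ∧ IsAP A d ∧ IsAP B d := by
  have hsum := card_etransform A B e
  obtain ⟨hcrit1, -⟩ := etransform_critical e (by omega) (by omega) (by omega : t ≤ #(B ∩ (-e +ᵥ A)))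
    (by omega) hcrit
  have h := ih (A ∪ (e +ᵥ B)) (B ∩ (-e +ᵥ A)) t (by omega) ht (by omega) he1 (by omega) hcrit1
  rcases h with ⟨h1, -, -⟩ | ⟨d, hd, hA1, hB1⟩
  · exfalso; omega
  · exact ⟨d, hd, isAP_of_etransform_isAP hd ht (by omega) (by omega) hAB hcrit (by omega) hA1 hB1⟩

/-- **Theorem 3, necessity, by strong induction on `|B|`**: a `t`-critical pair with `2 ≤ t`,
`t + 1 ≤ |A|, |B|`, `|A| + |B| ≤ p + t − 1` satisfies (iii) (`|A| = |B| = t + 1`, `B = g − A`) or (iv)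
(progressions with a common nonzero difference). [cite: NazarewiczEtAl2007, Thm 3] -/
theorem structure_of_critical :
    ∀ (n : ℕ) (A B : Finset (ZMod p)) (t : ℕ), #B = n → 2 ≤ t → t + 1 ≤ #A → t + 1 ≤ #B →
      #A + #B ≤ p + t - 1 → ∑ x, min t (rep A B x) = t * (#A + #B - t) →
      (#A = t + 1 ∧ #B = t + 1 ∧ ∃ g, B = A.image (g - ·)) ∨
        ∃ d, d ≠ 0 ∧ IsAP A d ∧ IsAP B d := by
  intro n
  induction n using Nat.strong_induction_on with
  | _ n ih =>
  intro A B t hBn ht htA htB hAB hcrit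
  have hp2 := hp.out.two_le
  have ih' : ∀ (A' B' : Finset (ZMod p)) (t' : ℕ), #B' < #B → 2 ≤ t' → t' + 1 ≤ #A' → t' + 1 ≤ #B' →
      #A' + #B' ≤ p + t' - 1 → ∑ x, min t' (rep A' B' x) = t' * (#A' + #B' - t') →
      (#A' = t' + 1 ∧ #B' = t' + 1 ∧ ∃ g, B' = A'.image (g - ·)) ∨
        ∃ d, d ≠ 0 ∧ IsAP A' d ∧ IsAP B' d :=
    fun A' B' t' hlt => ih #B' (by omega) A' B' t' rfl
  -- endpoint cases
  by_cases hBt : #B = t + 1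
  · rcases endpoint_card_succ (by omega) hBt htA hAB hcrit with ⟨hAt, g, hg⟩ | h
    · exact Or.inl ⟨hAt, hBt, g, hg⟩
    · exact Or.inr h
  by_cases hAt : #A = t + 1
  · rcases endpoint_card_succ_left (by omega) hAt htB hAB hcrit with ⟨hBt', g, hg⟩ | h
    · exact Or.inl ⟨hAt, hBt', g, hg⟩
    · exact Or.inr h
  have htA2 : t + 2 ≤ #A := by omega
  have htB2 : t + 2 ≤ #B := by omega
  by_cases hsum : #A + #B = p + t - 1
  · exact Or.inr (endpoint_card_add ht (by omega) (by omega) hsum hcrit)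
  have hAB2 : #A + #B ≤ p + t - 2 := by omega
  right
  -- Case A
  by_cases hgood : ∃ e : ZMod p, t + 1 ≤ #(B ∩ (-e +ᵥ A)) ∧ #(B ∩ (-e +ᵥ A)) + 1 ≤ #B
  · obtain ⟨e, he1, he2⟩ := hgood
    exact isAP_of_good_etransform ih' ht htA2 htB2 hAB2 hcrit he1 he2
  -- Case B: pass to the complement pair `(Aᶜ, B)` at level `|B| - t`
  by_cases hsmallE : ∃ e : ZMod p, 1 ≤ #(B ∩ (-e +ᵥ A)) ∧ #(B ∩ (-e +ᵥ A)) + 1 ≤ t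
  · obtain ⟨e, he1, he2⟩ := hsmallE
    have hAp : #A ≤ p := (card_le_univ A).trans (ZMod.card p).le
    have hcA : #Aᶜ = p - #A := by rw [card_compl, ZMod.card]
    have hdual := critical_compl_left (by omega : t ≤ #A) (by omega : t ≤ #B) hcrit
    set t' := #B - t with ht'
    have hce := card_inter_vadd_compl A B e
    have h := isAP_of_good_etransform (A := Aᶜ) (B := B) (t := t')
      (fun A' B' t'' hlt => ih' A' B' t'' hlt) (by omega) (by rw [hcA]; omega) (by omega)
      (by rw [hcA]; omega) hdual (e := e) (by omega) (by omega)
    obtain ⟨d, hd, hAc, hBd⟩ := h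
    refine ⟨d, hd, ?_, hBd⟩
    have := hAc.compl hd
    rwa [compl_compl] at this
  -- Case C: rigid
  push Not at hgood hsmallE
  have hrig : ∀ e : ZMod p, #(B ∩ (-e +ᵥ A)) = 0 ∨ #(B ∩ (-e +ᵥ A)) = t ∨ #(B ∩ (-e +ᵥ A)) = #B := by
    intro e
    have h1 := hgood e
    have h2 := hsmallE e
    have h3 : #(B ∩ (-e +ᵥ A)) ≤ #B := card_le_card inter_subset_left
    omega
  have hboth : (∃ d, d ≠ 0 ∧ IsAP A d) ∨ (∃ d, d ≠ 0 ∧ IsAP B d) := by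
    rcases le_total #B #A with hBA | hAB'
    · exact isAP_of_rigid ht htB2 hBA hAB2 hcrit hrig
    · -- swap the roles of `A` and `B`
      have hcrit' : ∑ x, min t (rep B A x) = t * (#B + #A - t) := by
        rw [add_comm #B, ← hcrit]; exact Fintype.sum_congr _ _ fun x => by rw [rep_comm]
      have hrigBA : ∀ e : ZMod p, #(A ∩ (-e +ᵥ B)) = 0 ∨ #(A ∩ (-e +ᵥ B)) = t ∨ #(A ∩ (-e +ᵥ B)) = #A := by
        intro e
        -- `|A ∩ (B - e)| = |B ∩ (A + e)|`
        have hset : #(A ∩ (-e +ᵥ B)) = #(B ∩ (-(-e) +ᵥ A)) := by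
          rw [neg_neg]
          refine card_nbij' (fun x => e + x) (fun x => -e + x) ?_ ?_ ?_ ?_
          · intro x hx
            simp only [mem_coe, mem_inter, mem_neg_vadd_finset_iff, vadd_eq_add] at hx ⊢
            rw [mem_vadd_finset]
            exact ⟨hx.2, ⟨x, hx.1, rfl⟩⟩
          · intro x hx
            simp only [mem_coe, mem_inter] at hx ⊢
            obtain ⟨y, hy, rfl⟩ := mem_vadd_finset.1 hx.2
            rw [vadd_eq_add, neg_add_cancel_left, mem_neg_vadd_finset_iff, vadd_eq_add]
            exact ⟨hy, hx.1⟩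
          · intro x _; simp
          · intro x _; simp
        rw [hset]
        have h3 : #(B ∩ (-(-e) +ᵥ A)) ≤ #A := by
          rw [← card_vadd_finset (-(-e)) A]; exact card_le_card inter_subset_right
        rcases hrig (-e) with h | h | h
        · exact Or.inl h
        · exact Or.inr (Or.inl h)
        · omega
      rcases isAP_of_rigid ht htA2 hAB' (by omega) hcrit' hrigBA with h | h
      · exact Or.inr h
      · exact Or.inl h
  rcases hboth with ⟨d, hd, hAd⟩ | ⟨d, hd, hBd⟩
  · exact ⟨d, hd, hAd, isAP_of_critical_of_isAP hd hAd ht (by omega) (by omega) (by omega) hcrit⟩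
  · exact ⟨d, hd, isAP_of_critical_of_isAP_right hd hBd ht (by omega) (by omega) (by omega) hcrit, hBd⟩

/-- **Theorem 3, the structural direction** ("a Vosper type theorem for Pollard's inequality"): let
`p` be prime, `2 ≤ t`, `A, B ⊆ ℤ/pℤ` with `t < min(|A|, |B|)`, `|A| + |B| < p + t`, and suppose
equality holds in Pollard's theorem, `N_1 + ⋯ + N_t = Σ_x min(t, r_{A,B}(x)) = t(|A| + |B| − t)`.
Then either `|A| = |B| = t + 1` and `B = g − A` for some `g`, or `A` and `B` are arithmetic
progressions with the same (nonzero) common difference. [cite: NazarewiczEtAl2007, Thm 3] -/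
theorem nazarewicz2007_thm3_inverse {A B : Finset (ZMod p)} {t : ℕ} (ht : 2 ≤ t) (htA : t < #A)
    (htB : t < #B) (hAB : #A + #B < p + t)
    (hcrit : ∑ x, min t (rep A B x) = t * (#A + #B - t)) :
    (#A = t + 1 ∧ #B = t + 1 ∧ ∃ g, B = A.image (g - ·)) ∨ ∃ d, d ≠ 0 ∧ IsAP A d ∧ IsAP B d :=
  structure_of_critical #B A B t rfl ht htA htB (by omega) hcrit

/-- **Theorem 3** (Nazarewicz–O'Brien–O'Neill–Staples 2007): for a prime `p`, `A, B ⊆ ℤ/pℤ` and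
`2 ≤ t ≤ min(|A|, |B|)`, equality holds in Pollard's theorem,
`Σ_x min(t, r_{A,B}(x)) = t · min(p, |A| + |B| − t)`, if and only if (i) `min(|A|, |B|) = t`, or
(ii) `|A| + |B| ≥ p + t`, or (iii) `|A| = |B| = t + 1` and `B = g − A` for some `g`, or (iv) `A` and
`B` are arithmetic progressions with the same common difference.  (Nonemptiness of `A, B` is implied
by `t ≥ 2`; in (iv) the common difference is automatically nonzero as `|A| ≥ 2`.)
[cite: NazarewiczEtAl2007, Thm 3] -/
theorem nazarewicz2007_thm3 {A B : Finset (ZMod p)} {t : ℕ} (ht : 2 ≤ t) (htA : t ≤ #A)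
    (htB : t ≤ #B) :
    ∑ x, min t (rep A B x) = t * min p (#A + #B - t) ↔
      (min #A #B = t ∨ p + t ≤ #A + #B ∨ (#A = t + 1 ∧ #B = t + 1 ∧ ∃ g, B = A.image (g - ·)) ∨
        ∃ d, IsAP A d ∧ IsAP B d) := by
  have hp2 := hp.out.two_le
  have hAp : #A ≤ p := (card_le_univ A).trans (ZMod.card p).le
  have hBp : #B ≤ p := (card_le_univ B).trans (ZMod.card p).le
  constructor
  · intro hcrit
    by_cases hmin : min #A #B = t
    · exact Or.inl hmin
    by_cases hii : p + t ≤ #A + #B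
    · exact Or.inr (Or.inl hii)
    have hmin' : min p (#A + #B - t) = #A + #B - t := min_eq_right (by omega)
    rw [hmin'] at hcrit
    have htA' : t < #A := by
      rcases Nat.lt_or_ge #A #B with h | h
      · rw [min_eq_left h.le] at hmin; omega
      · rw [min_eq_right h] at hmin; omega
    have htB' : t < #B := by
      rcases Nat.lt_or_ge #A #B with h | h
      · rw [min_eq_left h.le] at hmin; omega
      · rw [min_eq_right h] at hmin; omega
    rcases nazarewicz2007_thm3_inverse ht htA' htB' (by omega) hcrit with h | ⟨d, -, hAd, hBd⟩
    · exact Or.inr (Or.inr (Or.inl h))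
    · exact Or.inr (Or.inr (Or.inr ⟨d, hAd, hBd⟩))
  · intro h
    by_cases hii : p + t ≤ #A + #B
    · rw [critical_of_le_card_add hii, min_eq_left (by omega)]
    have hmin' : min p (#A + #B - t) = #A + #B - t := min_eq_right (by omega)
    rw [hmin']
    rcases h with hmin | hii' | ⟨hAt, hBt, g, hg⟩ | ⟨d, hAd, hBd⟩
    · rcases Nat.lt_or_ge #A #B with h | h
      · rw [min_eq_left h.le] at hmin; exact critical_of_card_eq_left hmin
      · rw [min_eq_right h] at hmin; exact critical_of_card_eq hmin
    · exact absurd hii' hii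
    · rw [hg]; exact critical_of_eq_image_sub g hAt (by omega)
    · have hd : d ≠ 0 := hAd.ne_zero (by omega)
      obtain ⟨a, hAeq⟩ := hAd
      obtain ⟨b, hBeq⟩ := hBd
      rw [hAeq, hBeq, card_apFinset hd hAp, card_apFinset hd hBp]
      exact critical_of_apFinset hd a b (by omega) htA htB (by omega)

/-! ### Consumer forms -/

/-- **Theorem 3 as a strict inequality** (the contrapositive reading): for a prime `p`,
`2 ≤ t < min(|A|, |B|)` and `|A| + |B| < p + t`, unless `|A| = |B| = t + 1` with `B = g − A`, or `A`
and `B` are arithmetic progressions with a common nonzero difference, Pollard's inequality is strict: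
`N_1 + ⋯ + N_t ≥ t(|A| + |B| − t) + 1`. [cite: NazarewiczEtAl2007, Thm 3] -/
theorem nazarewicz2007_thm3_strict {A B : Finset (ZMod p)} {t : ℕ} (ht : 2 ≤ t) (htA : t < #A)
    (htB : t < #B) (hAB : #A + #B < p + t)
    (hiii : ¬ (#A = t + 1 ∧ #B = t + 1 ∧ ∃ g, B = A.image (g - ·)))
    (hiv : ¬ ∃ d, d ≠ 0 ∧ IsAP A d ∧ IsAP B d) :
    t * (#A + #B - t) + 1 ≤ ∑ x, min t (rep A B x) := by
  have hpol := pollard A B (by omega : 1 ≤ t) htA.le htB.le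
  rw [min_eq_right (by omega : #A + #B - t ≤ p)] at hpol
  rcases hpol.lt_or_eq with hlt | heq
  · exact hlt
  · exfalso
    rcases nazarewicz2007_thm3_inverse ht htA htB hAB heq.symm with h | h
    · exact hiii h
    · exact hiv h

/-- The same in the vocabulary `Grynkiewicz.NS t A B = Σ_{x ∈ A + B} min(t, r_{A,B}(x))` of the tree's
Pollard-type census rules. [cite: NazarewiczEtAl2007, Thm 3] -/
theorem nazarewicz2007_thm3_strict_NS {A B : Finset (ZMod p)} {t : ℕ} (ht : 2 ≤ t) (htA : t < #A)
    (htB : t < #B) (hAB : #A + #B < p + t)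
    (hiii : ¬ (#A = t + 1 ∧ #B = t + 1 ∧ ∃ g, B = A.image (g - ·)))
    (hiv : ¬ ∃ d, d ≠ 0 ∧ IsAP A d ∧ IsAP B d) :
    t * (#A + #B - t) + 1 ≤ NS t A B := by
  rw [NS_eq_sum_of_subset t (subset_univ (A + B))]
  exact nazarewicz2007_thm3_strict ht htA htB hAB hiii hiv

end ZModP

end PollardEquality

end Literature.Combinatorics.Additive
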